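import Summits.CriticalPhenomena.Ising3DConformalLimit.Theses.EnergyNotSigmaSquared
import Summits.CriticalPhenomena.Ising3DConformalLimit.Theorems.GapForcesFarMerging.Negative.SoftShapes
import Literature.Probability.LatticeModels.SourcedDoubleCurrents
import Literature.Probability.LatticeModels.CurrentsSetConditioning
import Literature.Probability.LatticeModels.CurrentExplorationWeights

/-!
# Line `one-cluster-depletion-sandwich` — checked skeleton for crux `GapForcesFarMerging`
# (item stmt-CriticalPhenomena-4468, route `EnergyNotSigmaSquared`, rank 2)

Crux BY NAME: `Summit.CriticalPhenomena.Ising3DConformalLimit.Theses.EnergyNotSigmaSquared.GapForcesFarMerging`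
`= EnergyGapPowerLaw → FarMerging` (`crux_iff`, `Iff.rfl`; `Negative.SoftShapes.crux_iff`).
GAP: `⟨σ₀σ_{e₂} ; σ_xσ_{x+e₂}⟩_{β_c} ≤ C‖x‖^{-κ}⟨σ₀σ_x⟩²` on `ℤ³`, `κ > 0`. FarMerging: for one injective
lattice quadruple `y` and some `c > 0`, `U₄(Ly) ≤ -c⟨σσ⟩⟨σσ⟩` along infinitely many dilations `L`.

## The lever (idea card `Ideas/one-cluster-depletion-sandwich.md`, ideator 3; triage TRIAGE-r1-{1,2,3}: pass ×3)

Put hypothesis and conclusion of the crux on ONE kind of object: a pair of INDEPENDENT random sets.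
* Lemma A.1 of Aizenman–Duminil-Copin 2021 (tree: `Current.tsum_epairWeight_eq_tsum_mul_offRatio_set`)
  writes the two-current avoidance `A = P^{ox}⊗P^{ab}[o ↮ a]` (the random-current meaning of the
  truncated energy correlation, route item `EnergyFactorisation`) as an expected DEPLETION RATIO
  `E^{ox,∅}[𝟙[a,b ∉ C]·⟨σ_aσ_b⟩_{Λ∖C}/⟨σ_aσ_b⟩_Λ]`, `C = C_{n₁+n₂}(o)` ONE duplicated cluster.
* SANDWICH (this line's new lemma, sharpened during planning from the card's explored-backbone form to a
  ranking-free DOUBLE form, `DoubleSandwich` below): GKS super-multiplicativity of sourceless current sums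
  in deleted bonds (Aizenman 1982 Lemma 9.3, tree `Current.ecurrentSum_koff_union_mul_ge`) and the
  pair-cluster decomposition (tree `Current.tsum_pair_eq_sum_cluster`) give, for EVERY vertex set `C`,
  `P^{ab,∅}[C_{n₃+n₄}(a) ∩ C = ∅] ≤ ⟨σ_aσ_b⟩_{Λ∖C}/⟨σ_aσ_b⟩_Λ`, hence
  `P^{ox}⊗P^{ab}[o ↮ a in n₁+n₃] ≥ P^{ox,∅}⊗P^{ab,∅}[C_{n₁+n₂}(o) ∩ C_{n₃+n₄}(a) = ∅]`:
  the avoidance of two SOURCED currents dominates the avoidance of two INDEPENDENT DUPLICATED clusters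
  (the objects of ADC21 (3.13)/§4–6 and of route item `RungOneAdjacentMerging`). Triage r1-2 F3 showed
  that no event inclusion relates the two; the sandwich is the probability inequality that does.
* Consequence: GAP (two-current avoidance small, adjacent sources) ⟹ duplicated adjacent avoidance decays as
  a power; far merging needs duplicated FAR hitting (then the reverse of ADC21 (3.13) up to constants, stub
  6). So the crux becomes "a positive non-intersection exponent of two INDEPENDENT duplicated critical
  clusters tied at neighbouring nails forces macroscopic hitting" — the soft direction of intersection-
  exponent theory (Lawler 1991 ch. 3–5), run for two independent sets each with exact one- and two-point
  densities (`Current.tsum_epairWeight_mul_indicator_mem_cluster`, Prop. A.3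
  `Current.ecurrentSum_empty_mul_tsum_connInd_mul_connInd_le`).

## The line (7 registered stubs; `line_closes` composes their STATEMENTS sorry-free; `GapForcesFarMerging_of`
## concludes the crux BY NAME from the stubs; no `sorry` outside `stub_*`)

Far scale `t = 2^K`; one-pinch quadruple `pinch K = (0, p_K, e₂, q_K)`, `p_K = (2^K,0,2^K)`, `q_K = (2^K,0,-2^K)`
(adjacent pinch `0, e₂`; far ends `2^{K+1}` apart); all probabilities in the free box `Λ_n` (`freeBoxGraph 3 n`)
at `β_c(3)`, `n → ∞` first (`∀ᶠ n` / `∃ᶠ n`), exactly as route item `RungOneAdjacentMerging` is phrased.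

GAP →(S2 `stub_onePinchDecay`, uses S1 `stub_doubleSandwich`) four-current one-pinch avoidance
`avoid n (pinch K) ≤ C 2^{-κ'K}` along the (infinitely many) doubling octaves `K` →(S5 `stub_octaveCounting`,
fed by S3 `stub_hazardDomination` [HARDEST] and S4 `stub_tailTightness`) duplicated far hitting `≥ c` along
dilations `2^j•y` of ONE injective shape, frequently in `n` →(S6 `stub_fourToTwoMerging`) two-current far
merging `≥ c'` i.o. →(S7 `stub_farMergingSpins`) `FarMerging` (spins, ADC21 (3.11) in the box + box limits).

## Disproof used (tree `Cruxes/GapForcesFarMerging/Disproof.lean` v9 = gen 2 cycle 2, and the landed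
## `Theorems/GapForcesFarMerging/Negative/*.lean`, `SoftShapes` imported here)

* `not_crux_iff` / `crux_iff`: the skeleton proves `EnergyGapPowerLaw → FarMerging` and nothing weaker.
* `gapForcesFarMerging_false_without_model` (the MODEL is load-bearing; a proof must COUPLE quadruples of
  different shape/scale ON THE LATTICE): honoured at S2 (RP mirror couples the double-pinch GAP quadruple to
  the single-pinch one; Lemma A.1 + sandwich couple the single-pinch quadruple to a four-current system),
  S3 (couples octave `k` of the pinch system to fresh dilated shapes `2^j•y`, `|j-k| = O(1)`), S6. Every stub
  is a statement about sourced/duplicated random currents of the n.n. model in boxes of `ℤ³` or about exact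
  finite-graph current sums — none is a SoftPackage consequence; `gapShape_not_determined_by_bulk`: no stub
  passes through a scaling limit.
* gen-1 `cruxWithoutKappaPos_iff` (`0 < κ` load-bearing): `0 < κ'` is written INTO `OnePinchDecay`; `κ' > 0`
  is consumed in S5 (`κ' K log 2` of total hazard spread over `K+3` octaves).
* gen-1 §7 `io_ge_of_prod_le_two_pow` / `io_ge_needs_lt_one` / `density_of_prod_le_two_pow`: S5 is exactly
  this bookkeeping in contrapositive form and needs only "infinitely often"; the printed missing input for a
  DENSITY (`m_k ≤ 1-δ`) is never used; the two FLOORS S5 does need are named: the near-pinch floor (provable,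
  inside S5) and the tail floor (S4, open).
* gen-1 `farMerging_const_le_two`, `farMergingFor_criticalCorr_iff_merge`, `U4_criticalCorr_eq`: S7 is their
  finite-volume form (`c' ≤ 1` automatically: `merge ≤ 1`).
* `oneEndedGapForcesFarMerging_false_without_model`: the un-pinched residual is not soft — agreed; S3/S4/S6
  are current-level statements. `familyA_not_rpCauchySchwarz` (Negative/NotRP): RP (inside S2) is outside
  the package.
No stub is an instance of a landed Negative lemma (those refute only package-level transfers and the
`κ = 0` / `x = 0` degenerations).
-/

noncomputable section

namespace Summit.CriticalPhenomena.Ising3DConformalLimit.Cruxes.GapForcesFarMerging.OneClusterDepletionSandwich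

open scoped symmDiff ENNReal
open MeasureTheory Filter
open Literature.Probability.LatticeModels Literature.Probability.Percolation
open Summit.CriticalPhenomena.Ising3DConformalLimit.Theses.EnergyNotSigmaSquared

/-! ## Lattice vocabulary (all over existing declarations) -/

/-- `e₁ = (1,0,0)`: direction of the RP mirror / of GAP's far point `2^K e₁`. [folklore] -/
abbrev e₁ : Site 3 := Pi.single 0 1
/-- `e₂ = (0,1,0)`: the bond direction of GAP (`ε₀ = σ₀σ_{e₂}`, route file `Pi.single 1 1`). [folklore] -/
abbrev e₂ : Site 3 := Pi.single 1 1
/-- `e₃ = (0,0,1)`: the transverse direction separating the two far ends. [folklore] -/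
abbrev e₃ : Site 3 := Pi.single 2 1

/-- The critical two-point function `G(x) = ⟨σ₀σ_x⟩_{β_c(3)}`. [folklore] -/
abbrev G (x : Site 3) : ℝ := criticalTwoPoint 3 x

/-- Truncated pair–pair correlation `⟨σ_aσ_b ; σ_cσ_d⟩_{β_c(3)}`. [folklore] -/
def pairCov (a b c d : Site 3) : ℝ :=
  criticalCorr 3 4 ![a, b, c, d] - criticalCorr 3 2 ![a, b] * criticalCorr 3 2 ![c, d]

/-- Far source `p_K = (2^K, 0, 2^K)` of the one-pinch configuration at octave `K`. [folklore] -/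
def pFar (K : ℕ) : Site 3 := ((2 : ℤ) ^ K) • e₁ + ((2 : ℤ) ^ K) • e₃

/-- Far probe end `q_K = (2^K, 0, -2^K)` (`‖p_K - q_K‖ = 2^{K+1}`). [folklore] -/
def qFar (K : ℕ) : Site 3 := ((2 : ℤ) ^ K) • e₁ - ((2 : ℤ) ^ K) • e₃

/-- The ONE-PINCH quadruple at octave `K`: duplicated cluster of the pair `(0, p_K)`, independent duplicated
cluster of the pair `(e₂, q_K)` — one adjacent pinch `(0, e₂)`, far ends un-pinched. It is the image of
GAP's double-pinch quadruple `(0, e₂, 2^K e₁, 2^K e₁ + e₂)` paired with `(2^K e₃, -2^K e₃)` under the site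
mirror `u₀ ↦ 2^K - u₀`. [folklore] -/
def pinch (K : ℕ) : Fin 4 → Site 3 := ![0, pFar K, e₂, qFar K]

/-- DOUBLING WINDOW at octave `K` with constant `θ`: `G(2^{j+1}e₁) ≥ θ·G(2^j e₁)` for the seven octaves
`|j - K| ≤ 3`. Since `∏_{j<J} G(2^{j+1}e₁)/G(2^j e₁) ≥ c·4^{-J}` (`criticalTwoPoint_bounds_holds`), for
`θ < 4^{-7}` infinitely many `K` carry a window (pigeonhole); with Messager–Miracle-Solé folding a window
makes all values of `G` on `Λ_{2^{K+3}} ∖ Λ_{2^{K-3}}` comparable within `θ^{O(1)}`. [cite: AizenmanDuminilCopinAnnals2021, Def. 5.11 (P1)] -/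
def Doubling (θ : ℝ) (K : ℕ) : Prop :=
  ∀ j : ℕ, K ≤ j + 3 → j ≤ K + 3 → θ * G (((2 : ℤ) ^ j) • e₁) ≤ G (((2 : ℤ) ^ (j + 1)) • e₁)

/-! ## Random-current vocabulary: two INDEPENDENT DUPLICATED clusters in the box `Λ_n` at `β_c(3)` -/

/-- `β_c(3)`. [folklore] -/
abbrev βc : ℝ := criticalBeta 3

/-- Law of the PAIR OF TRACES `((n₁+n₂)^, (n₃+n₄)^)` of two independent sourced double currents of the free
box graph `freeBoxGraph 3 n`, sources `(∂n₁,∂n₂) = ({y₀,y₁}, ∅)`, `(∂n₃,∂n₄) = ({y₂,y₃}, ∅)` — ADC21's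
`P^{y₀y₁, y₂y₃, ∅, ∅}` with the pairing `(n₁,n₂)`, `(n₃,n₄)`, read on the traces (tree
`sourcedDoubleCurrentLaw`; junk `0` while a source is outside the box, immaterial under `∀ᶠ n`/`∃ᶠ n`).
[cite: AizenmanDuminilCopinAnnals2021, §3.1–3.2, eq. (3.13)] -/
def fourTraceLaw (n : ℕ) (y : Fin 4 → Site 3) : Measure (BondConfig (Site 3) × BondConfig (Site 3)) :=
  (sourcedDoubleCurrentLaw 3 n βc ({y 0} ∆ {y 1}) ∅).prod (sourcedDoubleCurrentLaw 3 n βc ({y 2} ∆ {y 3}) ∅)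

/-- The two duplicated clusters `C_{n₁+n₂}(y₀)` and `C_{n₃+n₄}(y₂)` share a vertex. [cite: AizenmanDuminilCopinAnnals2021, eq. (3.13)] -/
def Meet (y : Fin 4 → Site 3) : Set (BondConfig (Site 3) × BondConfig (Site 3)) :=
  {ω | ∃ u : Site 3, u ∈ openCluster ω.1 (y 0) ∧ u ∈ openCluster ω.2 (y 2)}

/-- The two duplicated clusters share a vertex of the ball `Λ_R = box 3 R`. [folklore] -/
def MeetIn (R : ℕ) (y : Fin 4 → Site 3) : Set (BondConfig (Site 3) × BondConfig (Site 3)) :=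
  {ω | ∃ u ∈ box 3 R, u ∈ openCluster ω.1 (y 0) ∧ u ∈ openCluster ω.2 (y 2)}

/-- DUPLICATED HITTING probability `P^{y₀y₁,∅}⊗P^{y₂y₃,∅}_{Λ_n}[C_{n₁+n₂}(y₀) ∩ C_{n₃+n₄}(y₂) ≠ ∅]`. [cite: AizenmanDuminilCopinAnnals2021, eq. (3.13)] -/
def meet (n : ℕ) (y : Fin 4 → Site 3) : ℝ := (fourTraceLaw n y).real (Meet y)

/-- DUPLICATED AVOIDANCE probability (total): `P[C_{n₁+n₂}(y₀) ∩ C_{n₃+n₄}(y₂) = ∅]`. [folklore] -/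
def avoid (n : ℕ) (y : Fin 4 → Site 3) : ℝ := (fourTraceLaw n y).real (Meet y)ᶜ

/-- DUPLICATED AVOIDANCE INSIDE THE BALL `Λ_R`: `P[C_{n₁+n₂}(y₀) ∩ C_{n₃+n₄}(y₂) ∩ Λ_R = ∅]` (non-increasing
in `R`, equal to `avoid` once `Λ_R` contains the box). [folklore] -/
def avoidIn (n R : ℕ) (y : Fin 4 → Site 3) : ℝ := (fourTraceLaw n y).real (MeetIn R y)ᶜ

/-- TWO-CURRENT MERGING probability `P^{y₀y₁, y₂y₃}_{Λ_n}[y₀ ↔ y₂ in n₁+n₂]` (the event of ADC21 (3.11):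
`U₄ = -2⟨σσ⟩⟨σσ⟩·P[merge]`), read on the trace of `n₁+n₂`. [cite: AizenmanDuminilCopinAnnals2021, eq. (3.11)] -/
def merge (n : ℕ) (y : Fin 4 → Site 3) : ℝ :=
  (sourcedDoubleCurrentLaw 3 n βc ({y 0} ∆ {y 1}) ({y 2} ∆ {y 3})).real {ω | y 2 ∈ openCluster ω (y 0)}

/-! ## Currencies of the line -/

open Classical in
/-- **DOUBLE SANDWICH** (finite graph, couplings `K ≥ 0`, un-normalised current-sum form). For vertices
`o x a x'`: `∑ 1{∂n₁=ox}1{∂n₂=∅}1{∂n₃=ax'}1{∂n₄=∅} w⁴ 𝟙[C_{n₁+n₂}(o) ∩ C_{n₃+n₄}(a) = ∅]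
 ≤ Z[∅]² · ∑ 1{∂n₁=ox}1{∂n₃=ax'} w w 𝟙[a ∉ C_{n₁+n₃}(o)]`, i.e. after division by `Z[ox]Z[ax']Z[∅]²`:
`P^{ox,∅}⊗P^{ax',∅}[C_{n₁+n₂}(o) ∩ C_{n₃+n₄}(a) = ∅] ≤ P^{ox}⊗P^{ax'}[o ↮ a in n₁+n₃]`.
Proof sketch (all ingredients proved in tree): (A) Lemma A.1 with `W = {o}`, `B = {a,x'}`,
`F = 𝟙[a ∉ C_{n₁+n₂}(o)]` (`Current.tsum_epairWeight_eq_tsum_mul_offRatio_set`; parity gives `x' ∉ C`):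
rhs `= ∑ 1{ox}1{∅} w w 𝟙[a,x' ∉ C] · Z_{off C}[ax']/Z_{off C}[∅]`, `C = C_{n₁+n₂}(o)`; (B) for every vertex set
`C`: decompose `(n₃,n₄)` by `T = C_{n₃+n₄}(a)` (`Current.tsum_pair_eq_sum_cluster`), in the full and in the
`C`-depleted model (`koff` on the bonds meeting `C`), and compare the exterior factors with
`Z_{off(T∪C)}[∅]·Z[∅] ≥ Z_{off T}[∅]·Z_{off C}[∅]` (`Current.ecurrentSum_koff_union_mul_ge`), giving
`∑ 1{ax'}1{∅} w w 𝟙[C_{n₃+n₄}(a) ∩ C = ∅] ≤ Z_{off C}[ax'] Z[∅]²/Z_{off C}[∅]`; (A)+(B) and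
`a ∈ C_{n₃+n₄}(a)`. [cite: AizenmanDuminilCopinAnnals2021, App. A Lemma A.1] [cite: AizenmanCMP1982, Lemma 9.3] -/
def DoubleSandwich : Prop :=
  ∀ (V : Type) [Fintype V] [DecidableEq V] (Γ : SimpleGraph V) [DecidableRel Γ.Adj]
    (K : Γ.edgeFinset → ℝ), (∀ ed, 0 ≤ K ed) → ∀ o x a x' : V,
    (∑' q : (Current Γ × Current Γ) × (Current Γ × Current Γ),
        epairWeight K ({o} ∆ {x}) ∅ q.1 * epairWeight K ({a} ∆ {x'}) ∅ q.2 *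
          (if Disjoint ((q.1.1 + q.1.2).cluster o) ((q.2.1 + q.2.2).cluster a) then 1 else 0))
      ≤ ecurrentSum K (∅ : Finset V) ^ 2 *
        ∑' p : Current Γ × Current Γ, epairWeight K ({o} ∆ {x}) ({a} ∆ {x'}) p *
          (if a ∉ (p.1 + p.2).cluster o then 1 else 0)

/-- (C1) ONE-PINCH DECAY: for some `κ' > 0`, along infinitely many doubling octaves `K`, eventually in the
box size, the two independent duplicated clusters of the one-pinch configuration avoid each other with
probability `≤ C·2^{-κ'K}` (predicted `κ' = κ/2 = Δ_ε - 2Δ_σ ≈ 0.376`). [folklore] -/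
def OnePinchDecay : Prop :=
  ∃ κ C θ : ℝ, 0 < κ ∧ 0 < θ ∧ ∃ᶠ K : ℕ in atTop, Doubling θ K ∧
    ∀ᶠ n : ℕ in atTop, avoid n (pinch K) ≤ C * ((2 : ℝ) ^ K) ^ (-κ)

/-- (C2) HAZARD DOMINATION (per octave, by fresh dilated shapes). There are a shape box `M`, a lag `k₁`,
`C` and `ε_k → 0` such that for every octave `1 ≤ k ≤ K+3` of a doubling far octave `K`, eventually in `n`:
if every injective shape `y ∈ (Λ_M)⁴` dilated by `2^j`, `k-k₁ ≤ j ≤ k+2`, has duplicated hitting `≤ c`,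
then the conditional hazard of the one-pinch system across the annulus `Λ_{2^k} ∖ Λ_{2^{k-1}}`,
`1 - avoidIn(2^k)/avoidIn(2^{k-1})`, is `≤ C·c + ε_k`. Content = T1/T3's residual made explicit:
(S) separation of the two clusters' exit points on `∂Λ_{2^{k-1}}` given avoidance inside, (D) ONE-SET
comparability of each cluster's annulus piece, given its own inside, with a fresh sourced duplicated cluster
(domain Markov `Current.tsum_pair_eq_sum_clusterSet`, source insertion `Current.ecurrentSum_empty_mul_tsum_avoidSet_le`,
two-passage chain rule `BackboneChainRuleTwo`), (H) relocation of the four effective sources to lattice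
points of `2^{k-k₁}ℤ³` (two-point Harnack at a windowed scale; ADC21 Thm 5.12 / Panis arXiv:2406.15243 Thm 5.3),
and NO joint conditioning of a merged pair. [cite: AizenmanDuminilCopinAnnals2021, §6.2 (6.11)–(6.13)] [cite: Lawler1991, ch. 3–5] -/
def HazardDomination : Prop :=
  ∀ θ : ℝ, 0 < θ → ∃ M k₁ : ℕ, ∃ C : ℝ, ∃ ε : ℕ → ℝ, Tendsto ε atTop (nhds 0) ∧
    ∀ k K : ℕ, 1 ≤ k → k ≤ K + 3 → Doubling θ K → ∀ᶠ n : ℕ in atTop, ∀ c : ℝ,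
      (∀ y : Fin 4 → Site 3, Function.Injective y → (∀ i, y i ∈ box 3 M) →
          ∀ j : ℕ, k ≤ j + k₁ → j ≤ k + 2 → meet n (fun i => ((2 : ℤ) ^ j) • y i) ≤ c) →
        avoidIn n (2 ^ (k - 1)) (pinch K) - avoidIn n (2 ^ k) (pinch K) ≤
          (C * c + ε k) * avoidIn n (2 ^ (k - 1)) (pinch K)

/-- (C3) TAIL TIGHTNESS: given that the two duplicated clusters of the one-pinch system at far octave `K`
avoid each other inside the ball `Λ_{2^{K+3}}` (which contains all four sources with margin `7·2^K`), they
avoid each other everywhere with conditional probability `≥ δ`, uniformly in doubling `K` and large `n`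
(both clusters would have to travel `≥ 7×` beyond their sources and meet out there). T3's named doubt:
annulus-crossing / re-entry tightness of a SOURCED duplicated cluster on `ℤ³` beyond its source scale, under
the avoidance tilt (ADC21 Lemma 6.2 is `d = 4`; in `d = 3` crossing bounds are ADS15-qualitative; first
moments are useless here since `E|C ∩ Ann_R| ≍ R·2^K` diverges). [cite: AizenmanDuminilCopinAnnals2021, Lemma 6.2] [cite: arXiv:2406.15243, §5] -/
def TailTightness : Prop :=
  ∀ θ : ℝ, 0 < θ → ∃ δ : ℝ, 0 < δ ∧ ∀ K : ℕ, Doubling θ K →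
    ∀ᶠ n : ℕ in atTop, δ * avoidIn n (2 ^ (K + 3)) (pinch K) ≤ avoid n (pinch K)

/-- (C4) FAR DUPLICATED HITTING, INFINITELY OFTEN: some injective lattice quadruple `y` and `c > 0` such
that along infinitely many dilations `L`, frequently in the box size, the independent duplicated clusters
`C_{n₁+n₂}(Ly₀)` (pair `Ly₀,Ly₁`) and `C_{n₃+n₄}(Ly₂)` (pair `Ly₂,Ly₃`) meet with probability `≥ c`. [cite: AizenmanDuminilCopinAnnals2021, eq. (3.13)] -/
def FarHitIO : Prop :=
  ∃ c : ℝ, 0 < c ∧ ∃ y : Fin 4 → Site 3, Function.Injective y ∧ ∀ L₀ : ℕ, ∃ L : ℕ, L₀ ≤ L ∧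
    ∃ᶠ n : ℕ in atTop, c ≤ meet n (fun i => (L : ℤ) • y i)

/-- (C5) FAR TWO-CURRENT MERGING, INFINITELY OFTEN: the same with the merging event of ADC21 (3.11),
`P^{Ly₀Ly₁, Ly₂Ly₃}_{Λ_n}[Ly₀ ↔ Ly₂ in n₁+n₂] ≥ c'`. [cite: AizenmanDuminilCopinAnnals2021, eq. (3.11)] -/
def FarMergeIO : Prop :=
  ∃ c : ℝ, 0 < c ∧ ∃ y : Fin 4 → Site 3, Function.Injective y ∧ ∀ L₀ : ℕ, ∃ L : ℕ, L₀ ≤ L ∧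
    ∃ᶠ n : ℕ in atTop, c ≤ merge n (fun i => (L : ℤ) • y i)

/-- The conclusion of the crux, verbatim (= `Negative.FarMergingShape Negative.cc2 (criticalCorr 3 4)`). [folklore] -/
def FarMerging : Prop :=
  ∃ c : ℝ, 0 < c ∧ ∃ x : Fin 4 → Site 3, Function.Injective x ∧ ∀ L₀ : ℕ, ∃ L : ℕ, L₀ ≤ L ∧
    criticalCorr 3 4 (fun i => (L : ℤ) • x i) -
      (criticalCorr 3 2 ![(L : ℤ) • x 0, (L : ℤ) • x 1] * criticalCorr 3 2 ![(L : ℤ) • x 2, (L : ℤ) • x 3] +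
       criticalCorr 3 2 ![(L : ℤ) • x 0, (L : ℤ) • x 2] * criticalCorr 3 2 ![(L : ℤ) • x 1, (L : ℤ) • x 3] +
       criticalCorr 3 2 ![(L : ℤ) • x 0, (L : ℤ) • x 3] * criticalCorr 3 2 ![(L : ℤ) • x 1, (L : ℤ) • x 2])
      ≤ -(c * (criticalCorr 3 2 ![(L : ℤ) • x 0, (L : ℤ) • x 1] * criticalCorr 3 2 ![(L : ℤ) • x 2, (L : ℤ) • x 3]))

/-- The crux is literally `EnergyGapPowerLaw → FarMerging`. [folklore] -/
theorem crux_iff :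
    Summit.CriticalPhenomena.Ising3DConformalLimit.Theses.EnergyNotSigmaSquared.GapForcesFarMerging ↔
      (EnergyGapPowerLaw → FarMerging) := Iff.rfl

/-- `FarMerging` is the landed Negative file's `FarMergingShape` of the critical correlators. [folklore] -/
theorem farMerging_iff_negative :
    FarMerging ↔ Theorems.GapForcesFarMerging.Negative.FarMergingShape
      Theorems.GapForcesFarMerging.Negative.cc2 (criticalCorr 3 4) := Iff.rfl

/-- Coordinates of the far ends (bookkeeping for `pinch_injective`). [folklore] -/
@[simp] theorem pFar_apply_zero (K : ℕ) : pFar K 0 = 2 ^ K := by simp [pFar]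
/-- Coordinates of the far ends. [folklore] -/
@[simp] theorem pFar_apply_two (K : ℕ) : pFar K 2 = 2 ^ K := by simp [pFar]
/-- Coordinates of the far ends. [folklore] -/
@[simp] theorem qFar_apply_zero (K : ℕ) : qFar K 0 = 2 ^ K := by simp [qFar]
/-- Coordinates of the far ends. [folklore] -/
@[simp] theorem qFar_apply_two (K : ℕ) : qFar K 2 = -2 ^ K := by simp [qFar]

/-- The one-pinch quadruple is injective (a legitimate four-source configuration; in particular all source
sets `{y₀} ∆ {y₁}`, `{y₂} ∆ {y₃}` are genuine pairs). [folklore] -/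
theorem pinch_injective (K : ℕ) : Function.Injective (pinch K) := by
  have h2 : (0 : ℤ) < 2 ^ K := pow_pos (by norm_num) K
  intro i j h
  have h0 := congrFun h 0
  have h1 := congrFun h 1
  have h3 := congrFun h 2
  fin_cases i <;> fin_cases j <;> simp [pinch, pFar, qFar] at h0 h1 h3 ⊢ <;> omega

/-! ## The seven registered stubs -/

/-- **S1 — DOUBLE SANDWICH** (M, provable now; the line's new lemma, finite graphs, general `K ≥ 0`). -/
theorem stub_doubleSandwich : DoubleSandwich := by
  sorry

/-- **S2 — GAP ⟹ one-pinch duplicated avoidance decays as a power along doubling octaves** (L, provable now,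
plumbing-heavy, no open input). Intended proof:
(i) RP UN-PINCHING (lever of the sibling cards rp-unpinch-single-passage / rp-gram-halving / rp-schwarz-single-pinch,
theorem-grade): reflection positivity through the site plane `{u₀ = 2^{K-1}}` (`isingTorus_reflectionPositive_sites_holds`,
finite-volume `isingMeasure_univ_free_reflectionPositive`, uniqueness `hasUniqueGibbsMeasure_criticalBeta_holds`,
box limits `criticalCorr_wellDefined_holds`) and `rp_cauchySchwarz_holds` with `F = ε₀ - ⟨ε₀⟩`,
`G = σ_{2^Ke₃}σ_{-2^Ke₃} - ⟨⟩`: `⟨ε₀ ; σ_{p_K}σ_{q_K}⟩² ≤ ⟨ε₀ ; ε_{2^K e₁}⟩ · ⟨σ_{2^Ke₃}σ_{-2^Ke₃} ; σ_{p_K}σ_{q_K}⟩`;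
the first factor is GAP at `x = 2^K e₁ ≠ 0`, the second is `≤ 2G(2^Ke₁)²` (Lebowitz `criticalUrsellFour_nonpos` +
plane MMS `G((2^K,0,2^{K+1})) ≤ G((2^K,0,0))`, `messager_miracleSole_holds`, `criticalCorr_two_pair`); hence
`pairCov 0 e₂ p_K q_K ≤ √(2C) 2^{-κK/2} G(2^Ke₁)²` for ALL `K`.
(ii) `EnergyFactorisation` (route item 4472, `ursellFour_eq_doubleCurrent_holds` twice) in the box:
`⟨ε₀;σ_pσ_q⟩_n = G_n(0,p)G_n(e₂,q)·A^{par}_n + G_n(0,q)G_n(e₂,p)·A^{cross}_n ≥ G_n(0,p)G_n(e₂,q)·A^{par}_n`.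
(iii) S1 + Lemma A.1, read through `sourcedDoubleCurrentLaw_apply` / `isingCorr_free_box_eq_boxGraph`:
`avoid n (pinch K) ≤ A^{par}_n` (`(q.1.1+q.1.2).cluster 0` disjoint from `(q.2.1+q.2.2).cluster e₂` is the
lifted-trace event `(Meet (pinch K))ᶜ`).
(iv) `n → ∞` (`criticalCorr_wellDefined_holds`, `tendsto_connectedFour_box_criticalBeta`), then MMS foldings
`G(p_K) ≥ G(2^{K+1}e₁)` (diagonal plane `u₀ - u₂ = 2^K`), `G(q_K - e₂) ≥ G((2^{K+1}+1)e₁) ≥ G(2^{K+2}e₁)`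
(hyperoctahedral symmetry, diagonal planes, axis monotonicity) and the window `Doubling θ K`:
`avoid ≤ √(2C)·θ^{-3}·2^{-κK/2}` eventually in `n`.
(v) infinitely many doubling `K` for `θ < 4^{-7}` (pigeonhole on `c‖x‖⁻² ≤ G ≤ 1`, `criticalTwoPoint_bounds_holds`).
[cite: AizenmanDuminilCopinAnnals2021, eq. (3.7) and Lemma A.1] [cite: FILS1978, Thm. 2.1] [cite: MessagerMiracleSoleJSP1977, main theorem] -/
theorem stub_onePinchDecay : DoubleSandwich → EnergyGapPowerLaw → OnePinchDecay := by
  sorry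

/-- **S3 — HAZARD DOMINATION** (XL, the HARDEST stub; open): per-octave domination of the conditional hazard of
the one-pinch system by fresh duplicated hittings of dilated lattice shapes at comparable scale, up to a
constant and an `ε_k → 0`. Why it might fail: (S) separation of exit points given avoidance, (D) one-set
un-tilting of the conditional annulus-piece laws and (H) source relocation are each unproved for sourced
currents on `ℤ³` (printed only sourceless, `d = 4`: ADC21 §6; additive and non-quantitative in `d = 3`:
Panis arXiv:2406.15243 Thm 2.4); the bet (card + triage r1-1/2/3) is that for two INDEPENDENT sets only
one-set, one-scale comparability and UPPER bounds given the past are needed. Logical status: implied by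
`liminf_k min_y meet(2^k•y) > 0`, so its content is exactly the regime where far hitting is small.
[cite: AizenmanDuminilCopinAnnals2021, §6.2] [cite: Lawler1991, ch. 3–5] [cite: arXiv:math/0508344] -/
theorem stub_hazardDomination : HazardDomination := by
  sorry

/-- **S4 — TAIL TIGHTNESS** (L–XL; open): the octaves beyond `Λ_{8·2^K}` cost at most a bounded factor of
avoidance. Why it might fail: needs that conditioning on the rare avoidance event (probability `≍ 2^{-κ'K}`,
decided near the pinch) does not make BOTH sourced duplicated clusters travel `7×` beyond their sources and
meet — a ratio-mixing / annulus-crossing statement for sourced currents on `ℤ³` with no printed proof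
(ADS15/Panis give qualitative, additive versions). [cite: AizenmanDuminilCopinAnnals2021, Lemma 6.2 and Thm 6.6] [cite: arXiv:2406.15243, Thm 2.4] -/
theorem stub_tailTightness : TailTightness := by
  sorry

/-- **S5 — OCTAVE COUNTING** (M–L, provable now). Intended proof (contrapositive): assume `¬FarHitIO`; then for
the finite family `y ∈ (Λ_M)⁴` and `L = 2^j` every duplicated hitting is eventually (in `j`, then in `n`)
below any `c > 0`, so by S3 the hazards `1 - h_{n,k}` are `≤ Cc + ε_k ≤ 1/2` for `k > k₀(c)`; with
`-log(1-s) ≤ 2s` on `[0,1/2]`: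
`avoid n (pinch K) ≥ [tail, S4] δ · avoidIn n (2^{K+3}) = δ · avoidIn n (2^{k₀}) · ∏_{k₀<k≤K+3} h_{n,k}
 ≥ δ·δ₀(k₀)·exp(-2∑_{k≤K+3}(Cc+ε_k)) = 2^{-(2Cc/log 2 + o(1))K}`,
using the NEAR-PINCH FLOOR `avoidIn n (2^{k₀}) (pinch K) ≥ δ₀(k₀) > 0` uniformly in `K ≥ k₀+2` and large `n`
(corridor construction: `n₃|_{E(Λ_{2^{k₀}})}` = a straight `-e₃`-corridor from `e₂`, `n₄ ≡ 0` on `E(Λ_{2^{k₀}})`,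
`n₁+n₂ ≡ 0` on the bonds meeting the corridor; its cost is bounded uniformly in the far ends by Lebowitz
`lebowitz_holds` + the local Simon–Lieb inequality (`LocalSimonLieb.lean`/`ModifiedSimonInequality.lean`) + GKS
`Current.ecurrentSum_koff_le`, i.e. `⟨σ_vσ_q⟩_{Λ∖D} ≥ c(D)⟨σ_vσ_q⟩_Λ` for a FIXED finite bond set `D`);
against `OnePinchDecay` (`avoid ≤ C'2^{-κ'K}` at infinitely many doubling `K`, eventually in `n`) this is
absurd once `c < κ' log 2/(4C)`. This is Disproof §7 STEP 1 (`io_ge_of_prod_le_two_pow`) run backwards; only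
"infinitely often" is produced, never a density of good octaves. [cite: AizenmanDuminilCopinAnnals2021, §6.2 (6.11)–(6.13)] -/
theorem stub_octaveCounting : OnePinchDecay → HazardDomination → TailTightness → FarHitIO := by
  sorry

/-- **S6 — FOUR-TO-TWO MERGING** (L–XL; open; SHARED cone debt): duplicated far hitting along dilations of a
fixed shape forces two-current far merging along dilations of a (possibly different) fixed shape — the
REVERSE, up to constants and at fat configurations, of Aizenman's monotonicity
`P^{xy,zt}[x ↔ z] ≤ P^{xy,zt,∅,∅}[C_{n₁+n₃}(x) ∩ C_{n₂+n₄}(z) ≠ ∅]` (ADC21 (3.13), Cor. A.2). Why it might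
fail: this is the single-versus-duplicated (FATNESS) step of every `d < 4` intersection argument since
Aizenman 1982 — single sourced currents may be polynomially thinner than duplicated clusters (route header,
why-might-fail of `EnergyGapPowerLaw`; cards top-heavy-bubble-nontriviality, FATNESS-LITE); known tools give
only the displayed direction. [cite: AizenmanDuminilCopinAnnals2021, eq. (3.13) and Cor. A.2] [cite: AizenmanCMP1982, Prop. 5.3] -/
theorem stub_fourToTwoMerging : FarHitIO → FarMergeIO := by
  sorry

/-- **S7 — FAR MERGING IS THE SPIN INEQUALITY** (M, provable now): ADC21 (3.11) in the box
(`connectedFour_free_box_eq`, proved; the merging event `{Ly₂ ∈ C_{n₁+n₂}(Ly₀)}` on the lifted trace is the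
tree's `tracedConn` pulled back by `sourcedTrace`, `SourcedDoubleCurrentsSwitching.lean`) gives
`U₄^{Λ_n}(Ly) = -2G_nG_n·merge n (Ly)`; `merge ≥ c'` frequently in `n` and the box limits
`tendsto_connectedFour_box_criticalBeta`, `criticalCorr_wellDefined_holds`, with `G(Ly₀,Ly₁)G(Ly₂,Ly₃) > 0`
(`criticalTwoPoint_bounds_holds`, `criticalCorr_two_pair`), give `U₄(Ly) ≤ -2c'·GG` for the same
infinitely many `L`. [cite: AizenmanDuminilCopinAnnals2021, eq. (3.11)] -/
theorem stub_farMergingSpins : FarMergeIO → FarMerging := by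
  sorry

/-! ## Composition: the stubs conclude the crux BY NAME -/

/-- The logic of the line, sorry-free: the seven stub STATEMENTS compose to `EnergyGapPowerLaw → FarMerging`
(the crux unfolded one step, `crux_iff`). Hypotheses are exactly the types of `stub_doubleSandwich`,
`stub_onePinchDecay`, `stub_hazardDomination`, `stub_tailTightness`, `stub_octaveCounting`,
`stub_fourToTwoMerging`, `stub_farMergingSpins`; `EnergyGapPowerLaw` is consumed once (S2). [folklore] -/
theorem line_closes
    (h₁ : DoubleSandwich)
    (h₂ : DoubleSandwich → EnergyGapPowerLaw → OnePinchDecay)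
    (h₃ : HazardDomination)
    (h₄ : TailTightness)
    (h₅ : OnePinchDecay → HazardDomination → TailTightness → FarHitIO)
    (h₆ : FarHitIO → FarMergeIO)
    (h₇ : FarMergeIO → FarMerging) :
    EnergyGapPowerLaw → FarMerging :=
  fun hgap => h₇ (h₆ (h₅ (h₂ h₁ hgap) h₃ h₄))

/-- **The skeleton theorem**: the crux BY NAME from the seven declared stubs (the only `sorry`s of the file
live inside `stub_*`; this proof term is `line_closes` applied to them, kernel-checked against the route decl
by `δ`-unfolding). [folklore] -/
theorem GapForcesFarMerging_of :
    Summit.CriticalPhenomena.Ising3DConformalLimit.Theses.EnergyNotSigmaSquared.GapForcesFarMerging :=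
  line_closes stub_doubleSandwich stub_onePinchDecay stub_hazardDomination stub_tailTightness
    stub_octaveCounting stub_fourToTwoMerging stub_farMergingSpins

end Summit.CriticalPhenomena.Ising3DConformalLimit.Cruxes.GapForcesFarMerging.OneClusterDepletionSandwich

end
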